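import Literature.Analysis.UnboundedOperators.HilleYosidaGenerator
import HarnessLib

/-!
# The Hille–Yosida generation theorem, part 4: rescaled semigroups and the quasi-contractive case
  `‖R(λ, A)‖ ≤ 1/(λ − ω)`

Analysis/UnboundedOperators support file (one definition with body, everything proved, no named
facts), continuing `HilleYosidaGenerator.lean`. Engel–Nagel (2000), Ch. II Cor. 3.6 (generation
theorem for quasi-contractive semigroups `‖T(t)‖ ≤ e^{ωt}`) is the contraction case applied to
`A − ω` together with the rescaling `e^{ωt}T(t)` (Engel–Nagel I.5.11 / II.2.2):

* §1 **`C0Semigroup.rescale T μ`**: the C₀-semigroup `t ↦ e^{μt}T(t)` (`μ ∈ ℂ`), with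
  `‖e^{μt}T(t)‖ ≤ M e^{(ω + Re μ)t}` and Laplace transform `R_{rescale}(λ) = R_T(λ − μ)`;
* §2 shifted pseudo-resolvents `σ ↦ J(σ − a)` and **`isHilleYosidaData_shift`**: a pseudo-resolvent
  `J` on `U ⊇ (−m, ∞)` with `‖J(λ)‖ ≤ 1/(λ + m)` (real `λ > −m`) and dense range gives Hille–Yosida
  data for `J(· − m)`;
* §3 **`exists_c0Semigroup_of_resolvent_bound`** (Engel–Nagel II Cor. 3.6 with `ω = −m`, in
  pseudo-resolvent form): such a `J` is the Laplace transform, on `U ∩ {Re λ > −m}`, of a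
  C₀-semigroup `T` with **`‖T(t)‖ ≤ e^{−mt}`**, whose generator is `operatorOfResolvent J z₀` for any
  `z₀ ∈ U` with `Re z₀ > −m`.

This is the shape in which coercive/Gårding resolvent bounds `‖(σ + A)⁻¹‖ ≤ 1/(m + Re σ)` arrive
(Lax–Milgram / Lions; e.g. the sheet linearisation's `resolventOdd` in
`Summits/…/OSWSelfSimilar/SheetRResolventOddClass.lean`, or `ρ(𝓛) ⊇ {Re λ > −¼}` for Jia–Šverák's
similarity-variable operator): they generate semigroups decaying like `e^{−mt}`.

## References

* K.-J. Engel, R. Nagel, *One-Parameter Semigroups for Linear Evolution Equations* (2000),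
  Ch. II Cor. 3.6, Thm. 3.5; rescaled semigroups I.5.11, II.2.2. [EngelNagel2000]
* T. Kato, *Perturbation Theory for Linear Operators* (1966), IX-§1.2, VIII-§1.1. [Kato1966]
-/

noncomputable section

open NormedSpace Filter Set Metric MeasureTheory Literature.Analysis.OperatorTheory
open scoped Topology NNReal

namespace Literature.Analysis.UnboundedOperators

/-! ### §1 Rescaled semigroups `e^{μt} T(t)` -/

namespace C0Semigroup

variable {E : Type*} [NormedAddCommGroup E] [NormedSpace ℂ E]

/-- **The rescaled semigroup** `t ↦ e^{μt}T(t)` of a C₀-semigroup `T` (`μ ∈ ℂ`); its generator is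
`A + μ` (Engel–Nagel II.2.2). [cite: EngelNagel2000, Ch. II §2.2] -/
def rescale (T : C0Semigroup ℂ E) (μ : ℂ) : C0Semigroup ℂ E where
  toMonoidHom :=
    { toFun := fun g => Complex.exp (μ * ((Multiplicative.toAdd g : ℝ≥0) : ℝ)) • T.app (Multiplicative.toAdd g)
      map_one' := by
        rw [toAdd_one, NNReal.coe_zero, Complex.ofReal_zero, mul_zero, Complex.exp_zero, one_smul, app_zero]
      map_mul' := fun a b => by
        rw [toAdd_mul, NNReal.coe_add, Complex.ofReal_add, mul_add, Complex.exp_add, app_add, smul_mul_smul] }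
  strongly_continuous := fun x => by
    have hc : Continuous fun t : ℝ≥0 => Complex.exp (μ * ((t : ℝ) : ℂ)) • T.app t x :=
      (Complex.continuous_exp.comp (continuous_const.mul
        (Complex.continuous_ofReal.comp NNReal.continuous_coe))).smul (T.continuous_app x)
    exact hc.comp continuous_toAdd

/-- `(T.rescale μ)(t) = e^{μt} T(t)`. [cite: EngelNagel2000, Ch. II §2.2] -/
theorem rescale_app (T : C0Semigroup ℂ E) (μ : ℂ) (t : ℝ≥0) :
    (T.rescale μ).app t = Complex.exp (μ * ((t : ℝ) : ℂ)) • T.app t := rfl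

/-- Growth bound of the rescaled semigroup: `‖e^{μt}T(t)‖ ≤ M e^{(ω + Re μ)t}`.
[cite: EngelNagel2000, Ch. II §2.2] -/
theorem norm_rescale_app_le (T : C0Semigroup ℂ E) {M ω : ℝ}
    (hM : ∀ t : ℝ≥0, ‖T.app t‖ ≤ M * Real.exp (ω * t)) (μ : ℂ) (t : ℝ≥0) :
    ‖(T.rescale μ).app t‖ ≤ M * Real.exp ((ω + μ.re) * t) := by
  rw [rescale_app]
  refine (norm_smul_le (Complex.exp (μ * ((t : ℝ) : ℂ))) (T.app t)).trans ?_
  rw [Complex.norm_exp, Complex.mul_re, Complex.ofReal_re, Complex.ofReal_im, mul_zero, sub_zero]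
  have hM0 : 0 ≤ M := by
    have h0 := hM 0
    rw [app_zero, NNReal.coe_zero, mul_zero, Real.exp_zero, mul_one] at h0
    exact (norm_nonneg _).trans h0
  calc Real.exp (μ.re * t) * ‖T.app t‖ ≤ Real.exp (μ.re * t) * (M * Real.exp (ω * t)) :=
        mul_le_mul_of_nonneg_left (hM t) (Real.exp_pos _).le
    _ = M * Real.exp ((ω + μ.re) * t) := by rw [add_mul, Real.exp_add]; ring

/-- **Laplace transform of the rescaled semigroup**: `R_{e^{μ·}T}(λ) x = R_T(λ − μ) x`
(`e^{−λt}e^{μt} = e^{−(λ−μ)t}`). [cite: EngelNagel2000, Ch. II §2.2] -/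
theorem rescale_laplaceResolventFun (T : C0Semigroup ℂ E) (μ l : ℂ) (x : E) :
    (T.rescale μ).laplaceResolventFun l x = T.laplaceResolventFun (l - μ) x := by
  rw [laplaceResolventFun, laplaceResolventFun]
  refine setIntegral_congr_fun measurableSet_Ioi fun t ht => ?_
  rw [rescale_app, smul_apply, smul_smul, ← Complex.exp_add, Real.coe_toNNReal _ (le_of_lt ht)]
  congr 1
  congr 1
  ring

end C0Semigroup

/-! ### §2 Shifted pseudo-resolvents and their Hille–Yosida data -/

namespace HilleYosida

variable {E : Type*} [NormedAddCommGroup E] [NormedSpace ℂ E] [CompleteSpace E]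
variable {U : Set ℂ} {J : ℂ → E →L[ℂ] E}

omit [CompleteSpace E] in
/-- The shift `σ ↦ J(σ − a)` of a pseudo-resolvent is a pseudo-resolvent on `U + a` (the resolvent of
`T + a`). [cite: Kato1966, VIII-§1.1] -/
theorem isPseudoResolvent_shift (hJ : IsPseudoResolvent U J) (a : ℂ) :
    IsPseudoResolvent {σ : ℂ | σ - a ∈ U} (fun σ => J (σ - a)) := by
  intro z hz w hw
  have h := hJ hz hw
  rwa [show w - a - (z - a) = w - z by ring] at h

omit [CompleteSpace E] in
/-- **Hille–Yosida data for the shift**: if `J` is a pseudo-resolvent on `U ⊇ (−m, ∞)` with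
`‖J(λ)‖ ≤ 1/(λ + m)` for real `λ > −m` and dense range, then `σ ↦ J(σ − m)` is Hille–Yosida data on
`U + m`. [cite: EngelNagel2000, Ch. II Cor. 3.6] -/
theorem isHilleYosidaData_shift (hJ : IsPseudoResolvent U J) {m : ℝ}
    (hmem : ∀ l : ℝ, -m < l → (l : ℂ) ∈ U) (hbound : ∀ l : ℝ, -m < l → ‖J l‖ ≤ (l + m)⁻¹)
    {z₀ : ℂ} (hz₀ : z₀ ∈ U) (hdense : Dense (Set.range (J z₀))) :
    IsHilleYosidaData {σ : ℂ | σ - m ∈ U} (fun σ => J (σ - m)) where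
  pseudo := isPseudoResolvent_shift hJ m
  mem l hl := by
    show (l : ℂ) - (m : ℂ) ∈ U
    rw [← Complex.ofReal_sub]
    exact hmem (l - m) (by linarith)
  norm_le l hl := by
    have h := hbound (l - m) (by linarith)
    rw [sub_add_cancel] at h
    rwa [← Complex.ofReal_sub]
  dense := by
    have h1 : ((1 : ℂ) - m) ∈ U := by
      have := hmem (1 - m) (by linarith)
      simpa using this
    have hr : Set.range (J (1 - (m : ℂ))) = Set.range (J z₀) := by
      have h := hJ.range_eq h1 hz₀
      have h' := congrArg (fun S : Submodule ℂ E => (S : Set E)) h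
      simpa only [LinearMap.coe_range, ContinuousLinearMap.coe_coe] using h'
    rw [hr]
    exact hdense

omit [CompleteSpace E] in
/-- Injectivity of `J(z₀)` under the hypotheses of `isHilleYosidaData_shift`. [cite: Kato1966, VIII-§1.1] -/
theorem injective_of_resolvent_bound (hJ : IsPseudoResolvent U J) {m : ℝ}
    (hmem : ∀ l : ℝ, -m < l → (l : ℂ) ∈ U) (hbound : ∀ l : ℝ, -m < l → ‖J l‖ ≤ (l + m)⁻¹)
    {z₀ : ℂ} (hz₀ : z₀ ∈ U) (hdense : Dense (Set.range (J z₀))) : Function.Injective (J z₀) := by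
  have h := (isHilleYosidaData_shift hJ hmem hbound hz₀ hdense).injective (z := z₀ + m)
    (by show z₀ + (m : ℂ) - m ∈ U; rwa [add_sub_cancel_right])
  simpa using h

/-! ### §3 The quasi-contractive generation theorem `‖T(t)‖ ≤ e^{−mt}` -/

/-- **Hille–Yosida, quasi-contractive case (Engel–Nagel II Cor. 3.6), pseudo-resolvent form.**
Let `J` be a pseudo-resolvent on `U ⊇ (−m, ∞)` with `‖J(λ)‖ ≤ 1/(λ + m)` for real `λ > −m` and dense
range. Then there is a C₀-semigroup `T` with `‖T(t)‖ ≤ e^{−mt}` whose Laplace transform is `J` on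
`U ∩ {Re λ > −m}` (`∫₀^∞ e^{−λt}T(t)x dt = J(λ)x`) and whose generator is the closed operator
`operatorOfResolvent J z₀` (any `z₀ ∈ U`, `Re z₀ > −m`): `T(t) = e^{−mt}S(t)` for the Hille–Yosida
contraction semigroup `S` of `J(· − m)`. [cite: EngelNagel2000, Ch. II Cor. 3.6] -/
theorem exists_c0Semigroup_of_resolvent_bound (hJ : IsPseudoResolvent U J) {m : ℝ}
    (hmem : ∀ l : ℝ, -m < l → (l : ℂ) ∈ U) (hbound : ∀ l : ℝ, -m < l → ‖J l‖ ≤ (l + m)⁻¹)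
    {z₀ : ℂ} (hz₀ : z₀ ∈ U) (hz₀' : -m < z₀.re) (hdense : Dense (Set.range (J z₀))) :
    ∃ T : C0Semigroup ℂ E, (∀ t : ℝ≥0, ‖T.app t‖ ≤ Real.exp (-m * t)) ∧
      (∀ l ∈ U, -m < l.re → ∀ x : E, T.laplaceResolventFun l x = J l x) ∧
      T.generator = operatorOfResolvent J z₀ (injective_of_resolvent_bound hJ hmem hbound hz₀ hdense) := by
  set h := isHilleYosidaData_shift hJ hmem hbound hz₀ hdense with hh
  set T : C0Semigroup ℂ E := h.semigroup.rescale (-(m : ℂ)) with hT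
  have hM : ∀ t : ℝ≥0, ‖T.app t‖ ≤ 1 * Real.exp (-m * t) := by
    intro t
    have := h.semigroup.norm_rescale_app_le h.norm_semigroup_app_le_exp (-(m : ℂ)) t
    simpa using this
  have hlap : ∀ l ∈ U, -m < l.re → ∀ x : E, T.laplaceResolventFun l x = J l x := by
    intro l hlU hl x
    rw [hT, C0Semigroup.rescale_laplaceResolventFun, sub_neg_eq_add]
    have h1 : l + (m : ℂ) ∈ {σ : ℂ | σ - m ∈ U} := by
      show l + (m : ℂ) - m ∈ U; rwa [add_sub_cancel_right]
    have h2 : 0 < (l + (m : ℂ)).re := by simp; linarith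
    rw [h.laplaceResolventFun_eq h1 h2]
    simp
  refine ⟨T, fun t => by simpa using hM t, hlap, ?_⟩
  -- generator: the closed operator of the Laplace transform, which is `J` at `z₀`
  rw [← C0Semigroup.operatorOfResolvent_laplaceResolvent_eq_generator T hM hz₀']
  apply LinearPMap.eq_of_eq_graph
  ext p
  have hJz : T.laplaceResolvent hM z₀ = J z₀ := by
    ext y
    rw [C0Semigroup.laplaceResolvent_apply _ _ hz₀', hlap z₀ hz₀ hz₀']
  rw [mem_graph_operatorOfResolvent_iff, mem_graph_operatorOfResolvent_iff, hJz]

end HilleYosida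

end Literature.Analysis.UnboundedOperators
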